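import Mathlib
import Summits.Ventures.PercRepro2.SharpHalves
import Summits.Ventures.PercRepro2.ReachBits
import Summits.Ventures.PercRepro2.MixedBoxDefs
import Summits.Ventures.PercRepro2.CellMonoRefutation

/-!
# SHARP-L is FALSE: a kernel-checked refutation of `SharpHalves.SharpL_all`
(blind cell PercRepro2, night-1 g35; proofs/NIGHT1-G35.md)

`SharpHalves.SharpL p ends o a₁ a₂ a₃ b` is `0 ≤ SL` with
`SL = P(T,bL,oL) P(T) P(R) − P(T,bL) P(T,oL) P(R) + P(R,bL) P(R,oH) P(T) − P(R,bL,oH) P(T) P(R)`,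
`T = Q ∩ {a₃ ∈ C(a₂)}`, `R = Q ∩ {a₃ ∉ C(a₂)}`, i.e. `P(T) Cov(1_{bL}, 1_{oL} | T) ≥ P(R) Cov(1_{bL}, 1_{oH} | R)`
— the `L`-half `Γ_L = 2 P(Q) Cov_Q(1_{bL}, Ξ_c)` of (HCOV) at the least centring `c₀ = P(oL | T) + P(oH | R)`
admitted by the two-point test functions (`SharpHalves.lean`; census-true on 766 random instances
`n = 5–7`).  It is false: the kit adversary (own code, 29,440 graphs / 117,760 weight climbs,
exact re-check) finds 5,948 exact negatives, down to `SL / (P(T) P(R) P(Q)) = −0.0179`.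

THE WITNESS — the double bond with a pendant: vertices `a₁ = 0`, `a₂ = 1`, `o = 2`, `b = 3`,
`a₃ = x = 4`; six edges `0–2`, `0–3` (weight `9/10`), `1–2`, `1–3` (`8/10`), `2–4`, `3–4` (`5/10`).
With the integer weight `wt ω = ∏_e (num_e if e open else 10 − num_e)` (`D = 10⁶`) the eight masses are

  `m(T) = 13600`, `m(T, bL) = 3600`, `m(T, oL) = 3600`, `m(T, bL, oL) = 0`,
  `m(R) = 57600`, `m(R, bL) = 44100`, `m(R, oH) = 9600`, `m(R, bL, oH) = 7200`,

so `SL · D³ = 0 − 3600·3600·57600 + 44100·9600·13600 − 7200·13600·57600 = −628 992 000 000 < 0`.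
Mechanism: given `a₃ ∈ C(a₂)`, the cluster of `a₂` reaches `x` through `o` or through `b`, so on `T`
the events `o ∈ L` and `b ∈ L` exclude each other (`m(T, bL, oL) = 0`): the membership-conditioned
covariance is `−P(T,bL) P(T,oL)/P(T)`, and the avoidance-conditioned BHK slack on `R` is too small to
cover it.  The `L`-half itself holds here at the true centring `γ`: `Γ_L = 0.00319 > 0`, `Γ_H = 0.00305 > 0`
(own code) — the centring `c₀` is the failure, not the half.  Consequence: the reduction
`SharpHalves.HCov_of_SharpL_SharpH` has a hypothesis that is false in general (as g34's
`HCov_all_of_a3Between_UU`); the identities `Gc_eq_halves`, `sharp_identity`, `GammaLc_eq_T_form`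
and the BHK brackets stand.

The masses are decided by the kernel with the bitmask reachability of `ReachBits.decConnB`
(`decide +kernel`, as in `CellMonoRefutation` and `UURefutation`); standard axioms; one seat.
-/

namespace Summit.Ventures.PercRepro2

namespace SharpHalvesRefutation

open UnionCluster CovForm SharpHalves

/-- The six edges of the witness on the vertices `0..4`: `0–2, 0–3, 1–2, 1–3, 2–4, 3–4`. -/
def ends : Fin 6 → Sym2 (Fin 5) := ![s(0, 2), s(0, 3), s(1, 2), s(1, 3), s(2, 4), s(3, 4)]

/-- The numerators of the edge weights (denominator `10`). -/
def num : Fin 6 → ℕ := ![9, 9, 8, 8, 5, 5]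

/-- The edge weights `num e / 10`. -/
def p : Fin 6 → ℚ := fun e => (num e : ℚ) / 10

/-- The integer weight of a configuration: `∏_e (num e if e open else 10 − num e)`. -/
def wt : Config (Fin 6) → ℕ := fun ω => ∏ e, (if ω e then num e else 10 - num e)

/-- Every numerator is at most `10`. -/
lemma num_le (e : Fin 6) : num e ≤ 10 := by fin_cases e <;> decide

/-- The weights are admissible. -/
lemma p_isProbVec : IsProbVec p :=
  ⟨fun e => by unfold p; positivity,
   fun e => by
    unfold p
    have h : (num e : ℚ) ≤ 10 := by exact_mod_cast num_le e
    linarith [div_le_one_of_le₀ h (by norm_num : (0 : ℚ) ≤ 10)]⟩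

/-- One Bernoulli factor as an integer numerator over `10`. -/
lemma edgeFactor_eq (e : Fin 6) (b : Bool) :
    edgeFactor (p e) b = ((if b then num e else 10 - num e : ℕ) : ℚ) / 10 := by
  cases b
  · have h : num e ≤ 10 := num_le e
    simp only [edgeFactor_false, p, Bool.false_eq_true, ↓reduceIte]
    rw [Nat.cast_sub h]
    push_cast
    ring
  · simp [edgeFactor_true, p]

/-- `weight p ω = wt ω / 10⁶`. -/
lemma weight_eq (ω : Config (Fin 6)) : weight p ω = (wt ω : ℚ) / 10 ^ 6 := by
  unfold weight wt
  simp only [edgeFactor_eq]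
  rw [Finset.prod_div_distrib, Finset.prod_const, Finset.card_univ, Fintype.card_fin, Nat.cast_prod]

/-- The bitmask decision of `Conn` on the witness (`ReachBits.decConnB`). -/
instance instDecConnFast (ω : Config (Fin 6)) : DecidableRel (Conn ends ω) := fun u v =>
  decConnB ends ω u v

/-- Membership in a connection event is decidable (fast). -/
instance instDecConnEvent (u v : Fin 5) : DecidablePred (· ∈ connEvent ends u v) := fun ω =>
  inferInstanceAs (Decidable (Conn ends ω u v))

/-- Membership in `T = {a₂ ↮ a₁, a₂ ↔ a₃}` is decidable (fast). -/
instance instDecT (a₁ a₂ a₃ : Fin 5) : DecidablePred (· ∈ TEvent ends a₁ a₂ a₃) := fun ω =>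
  inferInstanceAs (Decidable (ω ∈ (connEvent ends a₂ a₁)ᶜ ∩ connEvent ends a₂ a₃))

/-- Membership in `R = avoidAll ends 1 {0, 4}` is decidable (fast). -/
instance instDecR : DecidablePred (· ∈ avoidAll ends 1 {0, 4}) := fun ω =>
  inferInstanceAs (Decidable (∀ x ∈ ({0, 4} : Finset (Fin 5)), ¬ Conn ends ω 1 x))

set_option maxRecDepth 100000 in
set_option maxHeartbeats 4000000 in
/-- `m(T) = 13600`. -/
theorem mass_T : MixedBox.mass wt (TEvent ends 0 1 4) = 13600 := by
  rw [CellMonoRefutation.mass_eq_sum6]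
  decide +kernel

set_option maxRecDepth 100000 in
set_option maxHeartbeats 4000000 in
/-- `m(T, bL) = 3600`. -/
theorem mass_TbL : MixedBox.mass wt (TEvent ends 0 1 4 ∩ connEvent ends 0 3) = 3600 := by
  rw [CellMonoRefutation.mass_eq_sum6]
  decide +kernel

set_option maxRecDepth 100000 in
set_option maxHeartbeats 4000000 in
/-- `m(T, oL) = 3600`. -/
theorem mass_ToL : MixedBox.mass wt (TEvent ends 0 1 4 ∩ connEvent ends 0 2) = 3600 := by
  rw [CellMonoRefutation.mass_eq_sum6]
  decide +kernel

set_option maxRecDepth 100000 in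
set_option maxHeartbeats 4000000 in
/-- `m(T, bL, oL) = 0`: on `T` the cluster of `a₂` reaches `a₃` through `o` or through `b`. -/
theorem mass_TbLoL :
    MixedBox.mass wt (TEvent ends 0 1 4 ∩ (connEvent ends 0 2 ∩ connEvent ends 0 3)) = 0 := by
  rw [CellMonoRefutation.mass_eq_sum6]
  decide +kernel

set_option maxRecDepth 100000 in
set_option maxHeartbeats 4000000 in
/-- `m(R) = 57600`. -/
theorem mass_R : MixedBox.mass wt (avoidAll ends 1 {0, 4}) = 57600 := by
  rw [CellMonoRefutation.mass_eq_sum6]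
  decide +kernel

set_option maxRecDepth 100000 in
set_option maxHeartbeats 4000000 in
/-- `m(R, bL) = 44100`. -/
theorem mass_RbL : MixedBox.mass wt (avoidAll ends 1 {0, 4} ∩ connEvent ends 0 3) = 44100 := by
  rw [CellMonoRefutation.mass_eq_sum6]
  decide +kernel

set_option maxRecDepth 100000 in
set_option maxHeartbeats 4000000 in
/-- `m(R, oH) = 9600`. -/
theorem mass_RoH : MixedBox.mass wt (avoidAll ends 1 {0, 4} ∩ connEvent ends 1 2) = 9600 := by
  rw [CellMonoRefutation.mass_eq_sum6]
  decide +kernel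

set_option maxRecDepth 100000 in
set_option maxHeartbeats 4000000 in
/-- `m(R, bL, oH) = 7200`. -/
theorem mass_RbLoH :
    MixedBox.mass wt (avoidAll ends 1 {0, 4} ∩ (connEvent ends 1 2 ∩ connEvent ends 0 3)) = 7200 := by
  rw [CellMonoRefutation.mass_eq_sum6]
  decide +kernel

/-- **SHARP-L fails on the witness** at `(o, a₁, a₂, a₃, b) = (2, 0, 1, 4, 3)`:
`SL = −628 992 000 000 · 10⁻¹⁸ < 0`. -/
theorem not_SharpL : ¬ SharpL p ends 2 0 1 4 3 := by
  unfold SharpL SL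
  rw [MixedBox.prob_eq_mass_div weight_eq, MixedBox.prob_eq_mass_div weight_eq,
    MixedBox.prob_eq_mass_div weight_eq, MixedBox.prob_eq_mass_div weight_eq,
    MixedBox.prob_eq_mass_div weight_eq, MixedBox.prob_eq_mass_div weight_eq,
    MixedBox.prob_eq_mass_div weight_eq, MixedBox.prob_eq_mass_div weight_eq,
    mass_T, mass_TbL, mass_ToL, mass_TbLoL, mass_R, mass_RbL, mass_RoH, mass_RbLoH]
  norm_num

/-- **`SharpL_all ℚ` is false**: SHARP-L does not hold for every finite graph and every labelling —
the double bond with a pendant is a counterexample. -/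
theorem not_SharpL_all : ¬ SharpL_all ℚ := fun h =>
  not_SharpL (h (Fin 5) (Fin 6) ends p p_isProbVec 2 0 1 4 3 (by decide) (by decide) (by decide)
    (by decide) (by decide) (by decide) (by decide) (by decide) (by decide) (by decide))

end SharpHalvesRefutation

end Summit.Ventures.PercRepro2
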